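import Literature.Barriers.AtomisticToContinuum.DisorderedHarmonicChainPhases
import Mathlib.Analysis.SpecialFunctions.Complex.Arctan
import Mathlib.Analysis.SpecialFunctions.Log.Deriv
import HarnessLib

/-!
# Ajanki–Huveneers 2011, §3: proofs of the vendored expansions (discharges)

Sibling of `DisorderedHarmonicChainPhases.lean` (provefact unit
`AjankiHuveneers2011_spectralScaling`, decomposition layer 3). Discharged here:

* `AjankiHuveneers2011_PhiExpansion_holds` — Lemma 3.2, eq. (3.11): the second-order expansion
  `Φ(x,b) = sin²(πx)[wb + w²b²(π/2) sin 2πx] + 𝒪(w³|b| sin²πx)` of the phase correction, with the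
  explicit constant `π²(18M² + 1)`, `M = max(|b₋|, |b₊|)`, for `0 < w ≤ 1/(8π(1+M))`
  (`ahPhi_expansion`). Ingredients: `|arctan u - u| ≤ |u|³/(1 - u²)` from Gregory's series
  (`abs_arctan_sub_self_le`), and the algebra `u - N(1+e) = N[(1-q)(1+e) + e²]/(q-e)` for
  `u = N/(q-e)`, `N = πwb sin²πx`, `e = πwb sin πx cos πx`, `q = √(1-(πw/2)²)`.
* `AjankiHuveneers2011_phaseMonotone_holds` — Cor. 3.4 (i): `0 < f_b(x) - x` and
  `(1+b₋)w - Cw² ≤ f_b(x) - x ≤ (1+b₊)w + Cw²`, from the expansion of `Φ` and `w ≤ ϑ ≤ w + w³`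
  (`ahStep_increment_bounds`).

* `AjankiHuveneers2011_logGammaExpansion_holds` — Prop. 3.5, eqs. (3.19)–(3.21): the second-order
  expansion `log[sin πx / sin π(x+Φ)] = w s(x) b + w² r(x) b² + 𝒪(w³)` of one factor
  (`log_ahFactor_expansion`, via the real-variable core `log_factor_core`: `d = cos πΦ + cot πx sin πΦ
  = 1 + z`, `z = πSCwb + π²w²b²(S²C² - S⁴/2) + 𝒪(w³)`, `log(1+z) = z - z²/2 + 𝒪(z³)`), summed over
  the `n - 1` factors of `Γ^x_n`. (A first discharge of this fact, p21589 by a sibling unit, was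
  lost to a concurrent whole-file resubmission; this is an independent proof.)
* `ahFactor_bounds` — the pointwise core of (3.19): `e^{-Cw} ≤ sin πx / sin π(x + Φ(x,b)) ≤ e^{Cw}`
  (from `|Φ| ≤ Gw sin²πx`, `ahPhi_abs_le`), and `sin_pi_firstStep_bounds` — the denominator of
  Cor. 3.6, `sin π[ϑ + Φ(ϑ, B_1)] ≍ w`.

Source: O. Ajanki, F. Huveneers, CMP 301 (2011) 841–883, arXiv:1003.1076, Lemma 3.2 and
Appendix 7.1 ("a mechanical calculation"), Cor. 3.4 with (3.15)–(3.16).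
-/

noncomputable section

open Real

/-! ### Discharging the expansion of `Φ` (3.11) and Cor. 3.4 (i) -/

namespace Literature.Barriers.AtomisticToContinuum.HeatConduction

/-- Tail of Gregory's series after the linear term: `|arctan x - x| ≤ |x|³/(1 - x²)` for `|x| < 1`. [folklore] -/
theorem abs_arctan_sub_self_le {x : ℝ} (hx : |x| < 1) :
    |Real.arctan x - x| ≤ |x| ^ 3 / (1 - x ^ 2) := by
  have hxn : ‖x‖ < 1 := by rwa [Real.norm_eq_abs]
  have hsum := Real.hasSum_arctan hxn
  have htail := (hasSum_nat_add_iff' 1).2 hsum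
  simp only [Finset.range_one, Finset.sum_singleton, pow_zero, mul_zero, zero_add, pow_one,
    Nat.cast_one, div_one, one_mul] at htail
  have hx2 : x ^ 2 < 1 := by nlinarith [abs_nonneg x, sq_abs x]
  have hgeo : HasSum (fun i : ℕ ↦ |x| ^ 3 * (x ^ 2) ^ i) (|x| ^ 3 / (1 - x ^ 2)) := by
    have := (hasSum_geometric_of_lt_one (sq_nonneg x) hx2).mul_left (|x| ^ 3)
    simpa [div_eq_mul_inv] using this
  have hle : ∀ i : ℕ, ‖(-1 : ℝ) ^ (i + 1) * x ^ (2 * (i + 1) + 1) / ((2 * (i + 1) + 1 : ℕ) : ℝ)‖ ≤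
      |x| ^ 3 * (x ^ 2) ^ i := by
    intro i
    rw [Real.norm_eq_abs, abs_div, abs_mul, abs_pow, abs_neg, abs_one, one_pow, one_mul,
      Nat.abs_cast, abs_pow]
    have hden : (1 : ℝ) ≤ ((2 * (i + 1) + 1 : ℕ) : ℝ) := by
      exact_mod_cast (show 1 ≤ 2 * (i + 1) + 1 by omega)
    calc |x| ^ (2 * (i + 1) + 1) / ((2 * (i + 1) + 1 : ℕ) : ℝ)
        ≤ |x| ^ (2 * (i + 1) + 1) / 1 :=
          div_le_div_of_nonneg_left (pow_nonneg (abs_nonneg x) _) one_pos hden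
      _ = |x| ^ 3 * (x ^ 2) ^ i := by
          rw [div_one, ← sq_abs x, ← pow_mul, ← pow_add]
          ring_nf
  have := HasSum.norm_le_of_bounded htail hgeo hle
  rw [Real.norm_eq_abs] at this
  exact this

/-- `N = πw b sin²(πx)`. [cite: AjankiHuveneers2011, Lemma 3.2 eq. (3.10)] -/
theorem ahNum_eq (w x b : ℝ) : ahNum w x b = π * w * b * Real.sin (π * x) ^ 2 := by
  unfold ahNum
  rw [show 2 * π * x = 2 * (π * x) by ring, Real.cos_two_mul, Real.cos_sq']
  ring

/-- `D = √(1 - (πw/2)²) - πw b sin(πx) cos(πx)`. [cite: AjankiHuveneers2011, Lemma 3.2 eq. (3.10)] -/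
theorem ahDen_eq (w x b : ℝ) : ahDen w x b =
    Real.sqrt (1 - (π * w / 2) ^ 2) - π * w * b * Real.sin (π * x) * Real.cos (π * x) := by
  unfold ahDen
  rw [show 2 * π * x = 2 * (π * x) by ring, Real.sin_two_mul]
  ring

/-- **Lemma 3.2, eq. (3.11): the expansion of `Φ`, PROVED** with explicit constants: for
`|b| ≤ M := max(|b₋|,|b₊|)` and `0 < w ≤ 1/(8π(1+M))`,
`|Φ(x,b) - sin²(πx)(wb + w²b²(π/2) sin 2πx)| ≤ π²(18M² + 1) w³ |b| sin²(πx)`. With `N = πwbS²`,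
`e = πwbSC` (`S = sin πx`, `C = cos πx`), `q = √(1-(πw/2)²)`: `πΦ = arctan u`, `u = N/(q - e)`,
the main term is `N(1+e)/π`, `u - N(1+e) = N[(1-q)(1+e) + e²]/(q-e) = 𝒪(w³|b|S²)` and
`|arctan u - u| ≤ |u|³/(1-u²) = 𝒪(w³|b|³S⁶)`. [cite: AjankiHuveneers2011, Lemma 3.2 eq. (3.11)] -/
theorem ahPhi_expansion (bm bp : ℝ) :
    ∃ w₀ : ℝ, 0 < w₀ ∧ ∃ C : ℝ, ∀ w ∈ Set.Ioc 0 w₀, ∀ x : ℝ, ∀ b ∈ Set.Icc bm bp,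
      |ahPhi w x b - Real.sin (π * x) ^ 2 * (w * b + w ^ 2 * b ^ 2 * (π / 2) * Real.sin (2 * π * x))|
        ≤ C * w ^ 3 * |b| * Real.sin (π * x) ^ 2 := by
  obtain ⟨M, hM⟩ : ∃ M : ℝ, M = max |bm| |bp| := ⟨_, rfl⟩
  have hM0 : 0 ≤ M := hM ▸ le_max_of_le_left (abs_nonneg _)
  refine ⟨1 / (8 * π * (1 + M)), by positivity, π ^ 2 * (18 * M ^ 2 + 1), ?_⟩
  intro w hw x b hb
  obtain ⟨hw0, hw1⟩ := hw
  have hbM : |b| ≤ M := by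
    rw [hM]
    rcases le_or_gt 0 b with h | h
    · rw [abs_of_nonneg h]
      exact le_trans (le_trans hb.2 (le_abs_self _)) (le_max_right _ _)
    · rw [abs_of_neg h]
      exact le_trans (le_trans (neg_le_neg hb.1) (neg_le_abs _)) (le_max_left _ _)
  have hπ := Real.pi_pos
  have hε : π * w * (1 + M) ≤ 1 / 8 := by
    have := mul_le_mul_of_nonneg_left hw1 (by positivity : 0 ≤ π * (1 + M))
    calc π * w * (1 + M) = π * (1 + M) * w := by ring
      _ ≤ π * (1 + M) * (1 / (8 * π * (1 + M))) := this
      _ = 1 / 8 := by field_simp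
  have hπw : 0 ≤ π * w := by positivity
  have hπw1 : π * w ≤ 1 / 8 :=
    (le_mul_of_one_le_right hπw (by linarith only [hM0] : (1 : ℝ) ≤ 1 + M)).trans hε
  have hδ : π * w * |b| ≤ 1 / 8 :=
    (mul_le_mul_of_nonneg_left (hbM.trans (by linarith only [hM0] : M ≤ 1 + M)) hπw).trans hε
  -- bounds on sin, cos, and the square root, then generalize them away
  have hS1 := Real.sin_sq_le_one (π * x)
  have hSa := Real.abs_sin_le_one (π * x)
  have hCa := Real.abs_cos_le_one (π * x)
  have hq1 : Real.sqrt (1 - (π * w / 2) ^ 2) ≤ 1 := by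
    calc Real.sqrt (1 - (π * w / 2) ^ 2) ≤ Real.sqrt 1 :=
          Real.sqrt_le_sqrt (by nlinarith only [sq_nonneg (π * w / 2)])
      _ = 1 := Real.sqrt_one
  have hq0 : 1 - (π * w / 2) ^ 2 ≤ Real.sqrt (1 - (π * w / 2) ^ 2) := by
    have hy0 : 0 ≤ 1 - (π * w / 2) ^ 2 := by nlinarith only [hπw1, hπw]
    have hy1 : 1 - (π * w / 2) ^ 2 ≤ 1 := by nlinarith only [sq_nonneg (π * w / 2)]
    calc 1 - (π * w / 2) ^ 2 = Real.sqrt ((1 - (π * w / 2) ^ 2) ^ 2) := (Real.sqrt_sq hy0).symm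
      _ ≤ Real.sqrt (1 - (π * w / 2) ^ 2) :=
          Real.sqrt_le_sqrt (by nlinarith only [mul_le_mul_of_nonneg_left hy1 hy0])
  rw [ahPhi, ahNum_eq, ahDen_eq, show 2 * π * x = 2 * (π * x) by ring, Real.sin_two_mul]
  generalize hS : Real.sin (π * x) = S at *
  generalize hC : Real.cos (π * x) = Cc at *
  generalize hq : Real.sqrt (1 - (π * w / 2) ^ 2) = q at *
  -- the small quantities `e`, `N`, `u` and the main term `T`
  obtain ⟨e, he⟩ : ∃ e : ℝ, e = π * w * b * S * Cc := ⟨_, rfl⟩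
  obtain ⟨N, hN⟩ : ∃ N : ℝ, N = π * w * b * S ^ 2 := ⟨_, rfl⟩
  have hSC : |S * Cc| ≤ 1 := by
    rw [abs_mul]
    exact mul_le_one₀ hSa (abs_nonneg _) hCa
  have he_abs : |e| ≤ π * w * |b| := by
    rw [he, show π * w * b * S * Cc = (π * w * b) * (S * Cc) by ring, abs_mul, abs_mul,
      abs_of_nonneg hπw]
    calc π * w * |b| * |S * Cc| ≤ π * w * |b| * 1 :=
          mul_le_mul_of_nonneg_left hSC (by positivity)
      _ = π * w * |b| := mul_one _
  have hN_abs : |N| = π * w * |b| * S ^ 2 := by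
    rw [hN, abs_mul, abs_mul, abs_of_nonneg hπw, abs_of_nonneg (sq_nonneg S)]
  have hN_le : |N| ≤ 1 / 8 := by
    rw [hN_abs]
    calc π * w * |b| * S ^ 2 ≤ π * w * |b| * 1 := mul_le_mul_of_nonneg_left hS1 (by positivity)
      _ ≤ 1 / 8 := by linarith only [hδ]
  have hD : 1 / 2 ≤ q - e := by
    have h1 := abs_le.mp (he_abs.trans hδ)
    have ht : (π * w / 2) ^ 2 ≤ 1 / 256 := by nlinarith only [hπw1, hπw]
    linarith only [hq0, h1.2, ht]
  have hDpos : 0 < q - e := by linarith only [hD]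
  have hD0 : q - e ≠ 0 := hDpos.ne'
  rw [show q - π * w * b * S * Cc = q - e by rw [he], show π * w * b * S ^ 2 = N by rw [hN]]
  obtain ⟨u, hu⟩ : ∃ u : ℝ, u = N / (q - e) := ⟨_, rfl⟩
  rw [← hu]
  obtain ⟨T, hT⟩ : ∃ T : ℝ, T = S ^ 2 * (w * b + w ^ 2 * b ^ 2 * (π / 2) * (2 * S * Cc)) := ⟨_, rfl⟩
  rw [← hT]
  have hu_abs : |u| ≤ 2 * |N| := by
    rw [hu, abs_div, abs_of_pos hDpos, div_le_iff₀ hDpos]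
    calc |N| = 2 * |N| * (1 / 2) := by ring
      _ ≤ 2 * |N| * (q - e) := mul_le_mul_of_nonneg_left hD (by positivity)
  have hu1 : |u| ≤ 1 / 4 := by linarith only [hu_abs, hN_le]
  -- the arctan remainder
  have hat : |Real.arctan u - u| ≤ 2 * |u| ^ 3 := by
    have h := abs_arctan_sub_self_le (x := u) (by linarith only [hu1])
    have hu2 : u ^ 2 ≤ 1 / 16 := by
      have := pow_le_pow_left₀ (abs_nonneg u) hu1 2
      rw [sq_abs] at this
      linarith only [this]
    calc |Real.arctan u - u| ≤ |u| ^ 3 / (1 - u ^ 2) := h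
      _ ≤ |u| ^ 3 / (1 / 2) :=
          div_le_div_of_nonneg_left (by positivity) (by norm_num) (by linarith only [hu2])
      _ = 2 * |u| ^ 3 := by ring
  -- the algebra of the main term
  have hT' : π * T = N * (1 + e) := by
    rw [hT, hN, he]
    ring
  have huD : u * (q - e) = N := by rw [hu]; exact div_mul_cancel₀ N hD0
  have halg : u - π * T = N * ((1 - q) * (1 + e) + e ^ 2) / (q - e) := by
    rw [eq_div_iff hD0, sub_mul, huD, hT']
    ring
  have hmain : |u - π * T| ≤ 2 * |N| * ((π * w / 2) ^ 2 * (9 / 8) + (π * w * |b|) ^ 2) := by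
    rw [halg, abs_div, abs_of_pos hDpos, div_le_iff₀ hDpos, abs_mul]
    have h1 : |(1 - q) * (1 + e) + e ^ 2| ≤ (π * w / 2) ^ 2 * (9 / 8) + (π * w * |b|) ^ 2 := by
      have hee : e ^ 2 ≤ (π * w * |b|) ^ 2 := by
        rw [← sq_abs e]; exact pow_le_pow_left₀ (abs_nonneg e) he_abs 2
      have h1e : |1 + e| ≤ 9 / 8 := by
        have h2 := abs_le.mp (he_abs.trans hδ)
        rw [abs_le]; constructor <;> linarith only [h2.1, h2.2]
      calc |(1 - q) * (1 + e) + e ^ 2| ≤ |(1 - q) * (1 + e)| + |e ^ 2| := abs_add_le _ _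
        _ = (1 - q) * |1 + e| + e ^ 2 := by
            rw [abs_mul, abs_of_nonneg (sub_nonneg.mpr hq1), abs_of_nonneg (sq_nonneg e)]
        _ ≤ (π * w / 2) ^ 2 * (9 / 8) + (π * w * |b|) ^ 2 :=
            add_le_add (mul_le_mul (by linarith only [hq0]) h1e (abs_nonneg _) (sq_nonneg _)) hee
    calc |N| * |(1 - q) * (1 + e) + e ^ 2|
        ≤ |N| * ((π * w / 2) ^ 2 * (9 / 8) + (π * w * |b|) ^ 2) :=
          mul_le_mul_of_nonneg_left h1 (abs_nonneg N)
      _ ≤ |N| * ((π * w / 2) ^ 2 * (9 / 8) + (π * w * |b|) ^ 2) * (2 * (q - e)) :=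
          le_mul_of_one_le_right (by positivity) (by linarith only [hD])
      _ = 2 * |N| * ((π * w / 2) ^ 2 * (9 / 8) + (π * w * |b|) ^ 2) * (q - e) := by ring
  -- assemble
  have hS2 : 0 ≤ S ^ 2 := sq_nonneg S
  have hb0 : 0 ≤ |b| := abs_nonneg b
  have hfin : |Real.arctan u - π * T| ≤ π ^ 3 * (18 * M ^ 2 + 1) * w ^ 3 * |b| * S ^ 2 := by
    have hu3 : |u| ^ 3 ≤ 8 * |N| ^ 3 := by
      calc |u| ^ 3 ≤ (2 * |N|) ^ 3 := pow_le_pow_left₀ (abs_nonneg u) hu_abs 3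
        _ = 8 * |N| ^ 3 := by ring
    have hN3 : |N| ^ 3 ≤ π ^ 3 * M ^ 2 * (w ^ 3 * |b| * S ^ 2) := by
      rw [hN_abs]
      have hS4 : S ^ 2 * S ^ 2 ≤ 1 := by nlinarith only [hS1, hS2]
      have hb2 : |b| * |b| ≤ M * M := mul_le_mul hbM hbM hb0 hM0
      have hrest : 0 ≤ w ^ 3 * |b| * S ^ 2 := by positivity
      calc (π * w * |b| * S ^ 2) ^ 3
          = π ^ 3 * ((|b| * |b|) * (S ^ 2 * S ^ 2)) * (w ^ 3 * |b| * S ^ 2) := by ring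
        _ ≤ π ^ 3 * ((M * M) * 1) * (w ^ 3 * |b| * S ^ 2) := by
            refine mul_le_mul_of_nonneg_right (mul_le_mul_of_nonneg_left ?_ (by positivity)) hrest
            exact mul_le_mul hb2 hS4 (by positivity) (by positivity)
        _ = π ^ 3 * M ^ 2 * (w ^ 3 * |b| * S ^ 2) := by ring
    have hmain' : 2 * |N| * ((π * w / 2) ^ 2 * (9 / 8) + (π * w * |b|) ^ 2) ≤
        π ^ 3 * (9 / 16 + 2 * M ^ 2) * (w ^ 3 * |b| * S ^ 2) := by
      rw [hN_abs]
      have hb2 : |b| ^ 2 ≤ M ^ 2 := pow_le_pow_left₀ hb0 hbM 2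
      have hrest : 0 ≤ w ^ 3 * |b| * S ^ 2 := by positivity
      calc 2 * (π * w * |b| * S ^ 2) * ((π * w / 2) ^ 2 * (9 / 8) + (π * w * |b|) ^ 2)
          = π ^ 3 * (9 / 16 + 2 * |b| ^ 2) * (w ^ 3 * |b| * S ^ 2) := by ring
        _ ≤ π ^ 3 * (9 / 16 + 2 * M ^ 2) * (w ^ 3 * |b| * S ^ 2) :=
            mul_le_mul_of_nonneg_right (mul_le_mul_of_nonneg_left (by linarith only [hb2])
              (by positivity)) hrest
    have hsplit : Real.arctan u - π * T = (Real.arctan u - u) + (u - π * T) := by ring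
    calc |Real.arctan u - π * T| = |(Real.arctan u - u) + (u - π * T)| := by rw [← hsplit]
      _ ≤ |Real.arctan u - u| + |u - π * T| := abs_add_le _ _
      _ ≤ 2 * |u| ^ 3 + 2 * |N| * ((π * w / 2) ^ 2 * (9 / 8) + (π * w * |b|) ^ 2) :=
          add_le_add hat hmain
      _ ≤ 2 * (8 * (π ^ 3 * M ^ 2 * (w ^ 3 * |b| * S ^ 2))) +
            π ^ 3 * (9 / 16 + 2 * M ^ 2) * (w ^ 3 * |b| * S ^ 2) :=
          add_le_add (by linarith only [hu3, hN3]) hmain'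
      _ = π ^ 3 * (18 * M ^ 2 + 9 / 16) * w ^ 3 * |b| * S ^ 2 := by ring
      _ ≤ π ^ 3 * (18 * M ^ 2 + 1) * w ^ 3 * |b| * S ^ 2 := by
          have h18 : 18 * M ^ 2 + 9 / 16 ≤ 18 * M ^ 2 + 1 := by norm_num
          exact mul_le_mul_of_nonneg_right (mul_le_mul_of_nonneg_right (mul_le_mul_of_nonneg_right
            (mul_le_mul_of_nonneg_left h18 (by positivity)) (by positivity)) hb0) hS2
  -- divide by π
  have hdiv : Real.arctan u / π - T = (Real.arctan u - π * T) / π := by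
    field_simp
  rw [hdiv, abs_div, abs_of_pos hπ, div_le_iff₀ hπ]
  calc |Real.arctan u - π * T| ≤ π ^ 3 * (18 * M ^ 2 + 1) * w ^ 3 * |b| * S ^ 2 := hfin
    _ = π ^ 2 * (18 * M ^ 2 + 1) * w ^ 3 * |b| * S ^ 2 * π := by ring

/-- **Cor. 3.4 (i), PROVED** from the expansion of `Φ` and `w ≤ ϑ ≤ w + w³`: for
`-1 < b₋ ≤ 0 ≤ b₊` there are `w₀ > 0`, `C` with `0 < f_b(x) - x`,
`(1+b₋)w - Cw² ≤ f_b(x) - x ≤ (1+b₊)w + Cw²` (`|Φ - wb sin²πx| ≤ Kw²`, `b₋ ≤ b sin²πx ≤ b₊`).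
[cite: AjankiHuveneers2011, Cor. 3.4 (i)] -/
theorem ahStep_increment_bounds (bm bp : ℝ) (hbm : -1 < bm) (hbm0 : bm ≤ 0) (hbp : 0 ≤ bp) :
    ∃ w₀ : ℝ, 0 < w₀ ∧ ∃ C : ℝ, ∀ w ∈ Set.Ioc 0 w₀, ∀ x : ℝ, ∀ b ∈ Set.Icc bm bp,
      0 < ahStep w b x - x ∧ (1 + bm) * w - C * w ^ 2 ≤ ahStep w b x - x ∧
        ahStep w b x - x ≤ (1 + bp) * w + C * w ^ 2 := by
  obtain ⟨w₀, hw₀, C, hC⟩ := ahPhi_expansion bm bp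
  obtain ⟨M, hM⟩ : ∃ M : ℝ, M = max |bm| |bp| := ⟨_, rfl⟩
  have hM0 : 0 ≤ M := hM ▸ le_max_of_le_left (abs_nonneg _)
  obtain ⟨K, hK⟩ : ∃ K : ℝ, K = π / 2 * M ^ 2 + |C| * M := ⟨_, rfl⟩
  have hK0 : 0 ≤ K := by rw [hK]; positivity
  have h1bm : 0 < 1 + bm := by linarith
  refine ⟨min (min w₀ (1 / 5)) ((1 + bm) / (2 * (K + 1))), by positivity, K + 1, ?_⟩
  intro w hw x b hb
  obtain ⟨hw0, hw1⟩ := hw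
  have hwa : w ≤ w₀ := hw1.trans ((min_le_left _ _).trans (min_le_left _ _))
  have hw5 : w ≤ 1 / 5 := hw1.trans ((min_le_left _ _).trans (min_le_right _ _))
  have hwK : w ≤ (1 + bm) / (2 * (K + 1)) := hw1.trans (min_le_right _ _)
  have hw1' : w ≤ 1 := by linarith
  have hbM : |b| ≤ M := by
    rw [hM]
    rcases le_or_gt 0 b with h | h
    · rw [abs_of_nonneg h]
      exact le_trans (le_trans hb.2 (le_abs_self _)) (le_max_right _ _)
    · rw [abs_of_neg h]
      exact le_trans (le_trans (neg_le_neg hb.1) (neg_le_abs _)) (le_max_left _ _)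
  have hΦ := hC w ⟨hw0, hwa⟩ x b hb
  have hθ1 := ahTheta_ge hw0.le (by nlinarith [Real.pi_lt_d2] : π * w ≤ 2)
  have hθ2 := ahTheta_le hw0.le hw5
  have hstep : ahStep w b x - x = ahTheta w + ahPhi w x b := by unfold ahStep; ring
  -- `|Φ - w b sin²| ≤ K w²`
  have hS1 := Real.sin_sq_le_one (π * x)
  have hS0 := sq_nonneg (Real.sin (π * x))
  have hsin2 := Real.abs_sin_le_one (2 * π * x)
  have hw32 : w ^ 3 ≤ w ^ 2 := by nlinarith
  have hdev : |ahPhi w x b - w * b * Real.sin (π * x) ^ 2| ≤ K * w ^ 2 := by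
    have hsplit : ahPhi w x b - w * b * Real.sin (π * x) ^ 2 =
        (ahPhi w x b - Real.sin (π * x) ^ 2 * (w * b + w ^ 2 * b ^ 2 * (π / 2) * Real.sin (2 * π * x))) +
          w ^ 2 * b ^ 2 * (π / 2) * Real.sin (2 * π * x) * Real.sin (π * x) ^ 2 := by ring
    rw [hsplit]
    refine (abs_add_le _ _).trans ?_
    have hA : C * w ^ 3 * |b| * Real.sin (π * x) ^ 2 ≤ |C| * M * w ^ 2 := by
      calc C * w ^ 3 * |b| * Real.sin (π * x) ^ 2 ≤ |C| * w ^ 3 * |b| * Real.sin (π * x) ^ 2 := by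
            gcongr; exact le_abs_self C
        _ ≤ |C| * w ^ 3 * M * 1 := by gcongr
        _ ≤ |C| * w ^ 2 * M * 1 :=
            mul_le_mul_of_nonneg_right (mul_le_mul_of_nonneg_right
              (mul_le_mul_of_nonneg_left hw32 (abs_nonneg C)) hM0) zero_le_one
        _ = |C| * M * w ^ 2 := by ring
    have hB : |w ^ 2 * b ^ 2 * (π / 2) * Real.sin (2 * π * x) * Real.sin (π * x) ^ 2| ≤
        π / 2 * M ^ 2 * w ^ 2 := by
      rw [abs_mul, abs_mul, abs_mul, abs_mul, abs_of_nonneg (sq_nonneg w), abs_of_nonneg (sq_nonneg b),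
        abs_of_nonneg (by positivity : (0 : ℝ) ≤ π / 2), abs_of_nonneg hS0]
      have hb2 : b ^ 2 ≤ M ^ 2 := by rw [← sq_abs b]; exact pow_le_pow_left₀ (abs_nonneg b) hbM 2
      calc w ^ 2 * b ^ 2 * (π / 2) * |Real.sin (2 * π * x)| * Real.sin (π * x) ^ 2
          ≤ w ^ 2 * M ^ 2 * (π / 2) * 1 * 1 := by gcongr
        _ = π / 2 * M ^ 2 * w ^ 2 := by ring
    rw [hK]
    linarith [hΦ, hA, hB]
  have hdev' := abs_le.mp hdev
  -- `bm ≤ b sin² ≤ bp`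
  have hbS_lo : bm ≤ b * Real.sin (π * x) ^ 2 := by
    rcases le_or_gt 0 b with h | h
    · exact hbm0.trans (mul_nonneg h hS0)
    · calc bm ≤ b := hb.1
        _ = b * 1 := (mul_one b).symm
        _ ≤ b * Real.sin (π * x) ^ 2 := mul_le_mul_of_nonpos_left hS1 h.le
  have hbS_hi : b * Real.sin (π * x) ^ 2 ≤ bp := by
    rcases le_or_gt 0 b with h | h
    · calc b * Real.sin (π * x) ^ 2 ≤ b * 1 := mul_le_mul_of_nonneg_left hS1 h
        _ = b := mul_one b
        _ ≤ bp := hb.2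
    · exact le_trans (mul_nonpos_of_nonpos_of_nonneg h.le hS0) hbp
  have hlow : (1 + bm) * w - (K + 1) * w ^ 2 ≤ ahStep w b x - x := by
    rw [hstep]
    nlinarith [hdev'.1, mul_le_mul_of_nonneg_left hbS_lo hw0.le, sq_nonneg w]
  refine ⟨lt_of_lt_of_le ?_ hlow, hlow, ?_⟩
  · -- positivity of the lower bound
    have h2 : (K + 1) * w ≤ (1 + bm) / 2 := by
      calc (K + 1) * w ≤ (K + 1) * ((1 + bm) / (2 * (K + 1))) :=
            mul_le_mul_of_nonneg_left hwK (by positivity)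
        _ = (1 + bm) / 2 := by field_simp
    nlinarith
  · rw [hstep]
    nlinarith [hdev'.2, mul_le_mul_of_nonneg_left hbS_hi hw0.le, sq_nonneg w]

/-- `|Φ(x,b)| ≤ G w sin²(πx)` for `0 < w ≤ w₀`, `b ∈ [b₋, b₊]` (`G = M + (π/2)M² + |C|M` from the expansion
(3.11)). [cite: AjankiHuveneers2011, Lemma 3.2 eq. (3.11)] -/
theorem ahPhi_abs_le (bm bp : ℝ) :
    ∃ w₀ : ℝ, 0 < w₀ ∧ ∃ G : ℝ, 0 ≤ G ∧ ∀ w ∈ Set.Ioc 0 w₀, ∀ x : ℝ, ∀ b ∈ Set.Icc bm bp,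
      |ahPhi w x b| ≤ G * w * Real.sin (π * x) ^ 2 := by
  obtain ⟨w₀, hw₀, C, hC⟩ := ahPhi_expansion bm bp
  obtain ⟨M, hM⟩ : ∃ M : ℝ, M = max |bm| |bp| := ⟨_, rfl⟩
  have hM0 : 0 ≤ M := hM ▸ le_max_of_le_left (abs_nonneg _)
  refine ⟨min w₀ 1, by positivity, M + π / 2 * M ^ 2 + |C| * M, by positivity, ?_⟩
  intro w hw x b hb
  obtain ⟨hw0, hw1⟩ := hw
  have hwa : w ≤ w₀ := hw1.trans (min_le_left _ _)
  have hw1' : w ≤ 1 := hw1.trans (min_le_right _ _)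
  have hbM : |b| ≤ M := by
    rw [hM]
    rcases le_or_gt 0 b with h | h
    · rw [abs_of_nonneg h]
      exact le_trans (le_trans hb.2 (le_abs_self _)) (le_max_right _ _)
    · rw [abs_of_neg h]
      exact le_trans (le_trans (neg_le_neg hb.1) (neg_le_abs _)) (le_max_left _ _)
  have h := hC w ⟨hw0, hwa⟩ x b hb
  have hS0 : 0 ≤ Real.sin (π * x) ^ 2 := sq_nonneg _
  have hb2 : b ^ 2 ≤ M ^ 2 := by rw [← sq_abs b]; exact pow_le_pow_left₀ (abs_nonneg b) hbM 2
  have hw2 : w ^ 2 ≤ w := by nlinarith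
  have hw3 : w ^ 3 ≤ w := by nlinarith
  have h2 : |w * b + w ^ 2 * b ^ 2 * (π / 2) * Real.sin (2 * π * x)| ≤ (M + π / 2 * M ^ 2) * w := by
    refine (abs_add_le _ _).trans ?_
    rw [abs_mul, abs_of_pos hw0, abs_mul, abs_mul, abs_mul, abs_of_nonneg (sq_nonneg w),
      abs_of_nonneg (sq_nonneg b), abs_of_nonneg (by positivity : (0:ℝ) ≤ π / 2)]
    have hA : w * |b| ≤ w * M := mul_le_mul_of_nonneg_left hbM hw0.le
    have hB : w ^ 2 * b ^ 2 * (π / 2) * |Real.sin (2 * π * x)| ≤ w * M ^ 2 * (π / 2) * 1 :=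
      mul_le_mul (mul_le_mul_of_nonneg_right (mul_le_mul hw2 hb2 (sq_nonneg b) hw0.le)
        (by positivity)) (Real.abs_sin_le_one _) (abs_nonneg _) (by positivity)
    linarith
  have hmain : |Real.sin (π * x) ^ 2 * (w * b + w ^ 2 * b ^ 2 * (π / 2) * Real.sin (2 * π * x))| ≤
      (M + π / 2 * M ^ 2) * w * Real.sin (π * x) ^ 2 := by
    rw [abs_mul, abs_of_nonneg hS0]
    calc Real.sin (π * x) ^ 2 * |w * b + w ^ 2 * b ^ 2 * (π / 2) * Real.sin (2 * π * x)|
        ≤ Real.sin (π * x) ^ 2 * ((M + π / 2 * M ^ 2) * w) := mul_le_mul_of_nonneg_left h2 hS0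
      _ = (M + π / 2 * M ^ 2) * w * Real.sin (π * x) ^ 2 := by ring
  have hrem : C * w ^ 3 * |b| * Real.sin (π * x) ^ 2 ≤ |C| * M * w * Real.sin (π * x) ^ 2 := by
    calc C * w ^ 3 * |b| * Real.sin (π * x) ^ 2 ≤ |C| * w ^ 3 * |b| * Real.sin (π * x) ^ 2 := by
          gcongr; exact le_abs_self C
      _ = |C| * (w ^ 3 * |b|) * Real.sin (π * x) ^ 2 := by ring
      _ ≤ |C| * (w * M) * Real.sin (π * x) ^ 2 :=
          mul_le_mul_of_nonneg_right (mul_le_mul_of_nonneg_left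
            (mul_le_mul hw3 hbM (abs_nonneg b) hw0.le) (abs_nonneg C)) hS0
      _ = |C| * M * w * Real.sin (π * x) ^ 2 := by ring
  have htri := abs_add_le (ahPhi w x b - Real.sin (π * x) ^ 2 * (w * b + w ^ 2 * b ^ 2 * (π / 2) *
    Real.sin (2 * π * x))) (Real.sin (π * x) ^ 2 * (w * b + w ^ 2 * b ^ 2 * (π / 2) * Real.sin (2 * π * x)))
  rw [sub_add_cancel] at htri
  linarith

/-- **The single-factor bound (pointwise core of (3.19))**: `e^{-Cw} ≤ sin πx / sin π(x + Φ(x,b)) ≤ e^{Cw}`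
for `0 < w ≤ w₀`, all `x`, `b ∈ [b₋, b₊]` (`ahFactor`, including its continuous extension by `1`):
`sin π(x+Φ) = sin πx · d`, `d = cos πΦ + cot πx sin πΦ ∈ [1 - 2u, 1 + u]`, `u = πGw ≤ 1/4`.
[cite: AjankiHuveneers2011, Prop. 3.5 eq. (3.19)] -/
theorem ahFactor_bounds (bm bp : ℝ) :
    ∃ w₀ : ℝ, 0 < w₀ ∧ ∃ C : ℝ, 0 ≤ C ∧ ∀ w ∈ Set.Ioc 0 w₀, ∀ x : ℝ, ∀ b ∈ Set.Icc bm bp,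
      Real.exp (-(C * w)) ≤ ahFactor w x b ∧ ahFactor w x b ≤ Real.exp (C * w) := by
  obtain ⟨w₀, hw₀, G, hG0, hG⟩ := ahPhi_abs_le bm bp
  have hπ := Real.pi_pos
  refine ⟨min w₀ (1 / (4 * π * (G + 1))), by positivity, 4 * π * G, by positivity, ?_⟩
  intro w hw x b hb
  obtain ⟨hw0, hw1⟩ := hw
  have hwa : w ≤ w₀ := hw1.trans (min_le_left _ _)
  have hwG : w ≤ 1 / (4 * π * (G + 1)) := hw1.trans (min_le_right _ _)
  obtain ⟨u, hu⟩ : ∃ u : ℝ, u = π * G * w := ⟨_, rfl⟩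
  have hu0 : 0 ≤ u := by rw [hu]; positivity
  have hu4 : u ≤ 1 / 4 := by
    have h2 : π * (G + 1) * w ≤ π * (G + 1) * (1 / (4 * π * (G + 1))) :=
      mul_le_mul_of_nonneg_left hwG (by positivity)
    have h3 : π * (G + 1) * (1 / (4 * π * (G + 1))) = 1 / 4 := by field_simp
    rw [hu]
    nlinarith [mul_nonneg hπ.le hw0.le]
  have hΦ := hG w ⟨hw0, hwa⟩ x b hb
  have hS1 : Real.sin (π * x) ^ 2 ≤ 1 := Real.sin_sq_le_one _
  have hΦ' : |ahPhi w x b| ≤ G * w := hΦ.trans (by nlinarith [mul_nonneg hG0 hw0.le])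
  -- the case `sin πx = 0`
  by_cases hS00 : Real.sin (π * x) = 0
  · have : ahFactor w x b = 1 := by simp [ahFactor, hS00]
    rw [this]
    constructor
    · rw [Real.exp_le_one_iff, neg_nonpos]; positivity
    · rw [Real.one_le_exp_iff]; positivity
  -- the main case: `factor = 1/d`, `d = cos πΦ + cot πx sin πΦ`
  obtain ⟨d, hd⟩ : ∃ d : ℝ, d = Real.cos (π * ahPhi w x b) +
      Real.cos (π * x) / Real.sin (π * x) * Real.sin (π * ahPhi w x b) := ⟨_, rfl⟩
  have hsin : Real.sin (π * (x + ahPhi w x b)) = Real.sin (π * x) * d := by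
    rw [mul_add, Real.sin_add, hd]
    field_simp
  have hfac : ahFactor w x b = 1 / d := by
    rw [ahFactor, if_neg hS00, hsin]
    field_simp
  -- bounds on `d`
  have hcot : |Real.cos (π * x) / Real.sin (π * x) * Real.sin (π * ahPhi w x b)| ≤ u := by
    rw [abs_mul, abs_div]
    have h1 : |Real.sin (π * ahPhi w x b)| ≤ π * |ahPhi w x b| := by
      calc |Real.sin (π * ahPhi w x b)| ≤ |π * ahPhi w x b| := Real.abs_sin_le_abs
        _ = π * |ahPhi w x b| := by rw [abs_mul, abs_of_pos hπ]
    have hCa : |Real.cos (π * x)| ≤ 1 := Real.abs_cos_le_one _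
    have hSa : 0 < |Real.sin (π * x)| := abs_pos.mpr hS00
    have hSa1 : |Real.sin (π * x)| ≤ 1 := Real.abs_sin_le_one _
    calc |Real.cos (π * x)| / |Real.sin (π * x)| * |Real.sin (π * ahPhi w x b)|
        ≤ 1 / |Real.sin (π * x)| * (π * (G * w * Real.sin (π * x) ^ 2)) := by
          refine mul_le_mul (div_le_div_of_nonneg_right hCa hSa.le) (h1.trans ?_)
            (abs_nonneg _) (by positivity)
          exact mul_le_mul_of_nonneg_left hΦ hπ.le
      _ = u * |Real.sin (π * x)| := by
          rw [hu, ← sq_abs (Real.sin (π * x))]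
          field_simp
      _ ≤ u * 1 := mul_le_mul_of_nonneg_left hSa1 hu0
      _ = u := mul_one u
  have hcos1 : Real.cos (π * ahPhi w x b) ≤ 1 := Real.cos_le_one _
  have hcos0 : 1 - u ^ 2 / 2 ≤ Real.cos (π * ahPhi w x b) := by
    have h1 := Real.one_sub_sq_div_two_le_cos (x := π * ahPhi w x b)
    have h2 : (π * ahPhi w x b) ^ 2 ≤ u ^ 2 := by
      rw [← sq_abs (π * ahPhi w x b), abs_mul, abs_of_pos hπ]
      refine pow_le_pow_left₀ (by positivity) ?_ 2
      rw [hu]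
      nlinarith [hΦ']
    linarith
  have hcot' := abs_le.mp hcot
  have huu : u ^ 2 ≤ u := by nlinarith
  have hd_lo : 1 - 2 * u ≤ d := by rw [hd]; linarith [hcot'.1, hcos0]
  have hd_hi : d ≤ 1 + u := by rw [hd]; linarith [hcot'.2]
  have hd_pos : 0 < d := by linarith
  have hCw : 4 * π * G * w = 4 * u := by rw [hu]; ring
  rw [hfac, hCw]
  constructor
  · -- lower bound: `e^{-4u} ≤ e^{-u} ≤ 1/(1 + u) ≤ 1/d`
    rw [le_div_iff₀ hd_pos]
    have h1 := Real.add_one_le_exp u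
    have h2 : Real.exp (-(4 * u)) ≤ Real.exp (-u) := Real.exp_le_exp.mpr (by linarith)
    have h3 : Real.exp (-u) * Real.exp u = 1 := by rw [← Real.exp_add]; simp
    have h4 : 0 < Real.exp (-u) := Real.exp_pos _
    calc Real.exp (-(4 * u)) * d ≤ Real.exp (-u) * (1 + u) :=
          mul_le_mul h2 hd_hi hd_pos.le h4.le
      _ ≤ Real.exp (-u) * Real.exp u := mul_le_mul_of_nonneg_left (by linarith) h4.le
      _ = 1 := h3
  · -- upper bound: `1/d ≤ 1/(1 - 2u) ≤ 1 + 4u ≤ e^{4u}`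
    rw [div_le_iff₀ hd_pos]
    have h1 := Real.add_one_le_exp (4 * u)
    calc (1 : ℝ) ≤ (4 * u + 1) * (1 - 2 * u) := by nlinarith
      _ ≤ Real.exp (4 * u) * d := mul_le_mul h1 hd_lo (by linarith) (Real.exp_pos _).le

/-- **The first denominator of Cor. 3.6 is of order `w`**: `c w ≤ sin π(ϑ + Φ(ϑ, b)) ≤ C w` for
`0 < w ≤ w₀`, `b ∈ [b₋, b₊]` (`-1 < b₋ ≤ 0 ≤ b₊`), so that
`D_n(e₁) = Γ^ϑ_n sin πX^ϑ_n / sin π[ϑ + Φ(ϑ,B_1)] ∼ w⁻¹ Γ^ϑ_n sin πX^ϑ_n` as printed in (3.22).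
[cite: AjankiHuveneers2011, Cor. 3.6 eq. (3.22)] -/
theorem sin_pi_firstStep_bounds (bm bp : ℝ) (hbm : -1 < bm) (hbm0 : bm ≤ 0) (hbp : 0 ≤ bp) :
    ∃ w₀ : ℝ, 0 < w₀ ∧ ∃ c C : ℝ, 0 < c ∧ 0 < C ∧ ∀ w ∈ Set.Ioc 0 w₀, ∀ b ∈ Set.Icc bm bp,
      c * w ≤ Real.sin (π * (ahTheta w + ahPhi w (ahTheta w) b)) ∧
        Real.sin (π * (ahTheta w + ahPhi w (ahTheta w) b)) ≤ C * w := by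
  obtain ⟨w₀, hw₀, C', hC'⟩ := ahStep_increment_bounds bm bp hbm hbm0 hbp
  have hπ := Real.pi_pos
  have h1bm : 0 < 1 + bm := by linarith
  obtain ⟨C, hCdef⟩ : ∃ C : ℝ, C = max C' 0 := ⟨_, rfl⟩
  have hC0 : 0 ≤ C := hCdef ▸ le_max_right _ _
  have hCC : C' ≤ C := hCdef ▸ le_max_left _ _
  have hC : ∀ w ∈ Set.Ioc 0 w₀, ∀ x : ℝ, ∀ b ∈ Set.Icc bm bp,
      0 < ahStep w b x - x ∧ (1 + bm) * w - C * w ^ 2 ≤ ahStep w b x - x ∧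
        ahStep w b x - x ≤ (1 + bp) * w + C * w ^ 2 := by
    intro w hw x b hb
    obtain ⟨h1, h2, h3⟩ := hC' w hw x b hb
    have : C' * w ^ 2 ≤ C * w ^ 2 := mul_le_mul_of_nonneg_right hCC (sq_nonneg w)
    exact ⟨h1, by linarith, by linarith⟩
  refine ⟨min w₀ (min ((1 + bm) / (2 * (C + 1))) (1 / (4 * (2 + bp + C)))), by positivity,
    1 + bm, π * (2 + bp + C), h1bm, by positivity, ?_⟩
  intro w hw b hb
  obtain ⟨hw0, hw1⟩ := hw
  have hwa : w ≤ w₀ := hw1.trans (min_le_left _ _)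
  have hwb : w ≤ (1 + bm) / (2 * (C + 1)) := hw1.trans ((min_le_right _ _).trans (min_le_left _ _))
  have hwc : w ≤ 1 / (4 * (2 + bp + C)) := hw1.trans ((min_le_right _ _).trans (min_le_right _ _))
  obtain ⟨hpos, hlo, hhi⟩ := hC w ⟨hw0, hwa⟩ (ahTheta w) b hb
  have heq : ahStep w b (ahTheta w) - ahTheta w = ahTheta w + ahPhi w (ahTheta w) b := by
    unfold ahStep; ring
  rw [heq] at hpos hlo hhi
  set y := ahTheta w + ahPhi w (ahTheta w) b with hy
  -- `y ≤ 1/2`, so `πy ∈ (0, π/2]`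
  have hw1' : w ≤ 1 := by
    have : (0 : ℝ) < 4 * (2 + bp + C) := by positivity
    have h4 : 1 / (4 * (2 + bp + C)) ≤ 1 := by
      rw [div_le_one this]; nlinarith
    exact hwc.trans h4
  have hyhi : y ≤ (2 + bp + C) * w := by
    have hw2 : w ^ 2 ≤ w := by nlinarith
    have : C * w ^ 2 ≤ C * w := mul_le_mul_of_nonneg_left hw2 hC0
    nlinarith
  have hy2 : y ≤ 1 / 2 := by
    have : (2 + bp + C) * w ≤ (2 + bp + C) * (1 / (4 * (2 + bp + C))) :=
      mul_le_mul_of_nonneg_left hwc (by positivity)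
    have h2 : (2 + bp + C) * (1 / (4 * (2 + bp + C))) = 1 / 4 := by field_simp
    linarith
  have hCw : C * w ≤ (1 + bm) / 2 := by
    calc C * w ≤ (C + 1) * w := by nlinarith
      _ ≤ (C + 1) * ((1 + bm) / (2 * (C + 1))) := mul_le_mul_of_nonneg_left hwb (by positivity)
      _ = (1 + bm) / 2 := by field_simp
  have hylo : (1 + bm) / 2 * w ≤ y := by nlinarith
  constructor
  · -- `sin πy ≥ (2/π) πy = 2y ≥ (1+bm) w`
    have h1 := Real.mul_le_sin (x := π * y) (by positivity) (by nlinarith)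
    have h2 : 2 / π * (π * y) = 2 * y := by field_simp
    rw [h2] at h1
    linarith
  · calc Real.sin (π * y) ≤ π * y := Real.sin_le (by positivity)
      _ ≤ π * ((2 + bp + C) * w) := mul_le_mul_of_nonneg_left hyhi hπ.le
      _ = π * (2 + bp + C) * w := by ring

/-! ### Discharging the exponential representation (3.21) of the amplitude -/

/-- `|log(1+z) - (z - z²/2)| ≤ 2|z|³` for `|z| ≤ 1/2`. [folklore] -/
theorem abs_log_one_add_sub_le {z : ℝ} (hz : |z| ≤ 1 / 2) :
    |Real.log (1 + z) - (z - z ^ 2 / 2)| ≤ 2 * |z| ^ 3 := by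
  have h := Real.abs_log_sub_add_sum_range_le (x := -z) (by rw [abs_neg]; linarith) 2
  simp only [Finset.sum_range_succ, Finset.sum_range_zero, zero_add, pow_one, sub_neg_eq_add,
    abs_neg] at h
  norm_num at h
  have h2 : |z| ^ 3 / (1 - |z|) ≤ 2 * |z| ^ 3 := by
    rw [div_le_iff₀ (by linarith)]
    nlinarith [pow_nonneg (abs_nonneg z) 3]
  calc |Real.log (1 + z) - (z - z ^ 2 / 2)| = |-z + z ^ 2 / 2 + Real.log (1 + z)| := by
        rw [show Real.log (1 + z) - (z - z ^ 2 / 2) = -z + z ^ 2 / 2 + Real.log (1 + z) by ring]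
    _ ≤ |z| ^ 3 / (1 - |z|) := by
        convert h using 2
    _ ≤ 2 * |z| ^ 3 := h2

/-- `|sin t - t| ≤ |t|³` for `|t| ≤ 1`. [folklore] -/
theorem abs_sin_sub_self_le {t : ℝ} (ht : |t| ≤ 1) : |Real.sin t - t| ≤ |t| ^ 3 := by
  have h := Real.sin_bound ht
  have h0 := abs_nonneg t
  have h3 : |t| ^ 5 ≤ |t| ^ 3 := by
    calc |t| ^ 5 = |t| ^ 3 * (|t| * |t|) := by ring
      _ ≤ |t| ^ 3 * (1 * 1) := by gcongr
      _ = |t| ^ 3 := by ring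
  calc |Real.sin t - t| = |(Real.sin t - (t - t ^ 3 / 6)) + (-(t ^ 3 / 6))| := by ring_nf
    _ ≤ |Real.sin t - (t - t ^ 3 / 6)| + |-(t ^ 3 / 6)| := abs_add_le _ _
    _ ≤ |t| ^ 5 / 100 + |t| ^ 3 / 6 := by
        gcongr
        rw [abs_neg, abs_div, abs_of_pos (by norm_num : (0:ℝ) < 6), abs_pow]
    _ ≤ |t| ^ 3 := by nlinarith [pow_nonneg h0 3]

/-- `|cos t - (1 - t²/2)| ≤ t⁴` for `|t| ≤ 1`. [folklore] -/
theorem abs_cos_sub_le {t : ℝ} (ht : |t| ≤ 1) : |Real.cos t - (1 - t ^ 2 / 2)| ≤ t ^ 4 := by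
  have h := Real.cos_bound ht
  have : |t| ^ 4 = t ^ 4 := by
    rw [show (4 : ℕ) = 2 * 2 from rfl, pow_mul, pow_mul, sq_abs]
  nlinarith [pow_nonneg (abs_nonneg t) 4]
set_option maxHeartbeats 400000 in -- buildfix (bf3-g26): 160k/180k FAIL, 200k PASS at accept time; line-neutral budget line
/-- **Algebraic core of (3.19)**: the second-order expansion of `-log(cos πΦ + cot πx sin πΦ)`
(`= log` of the factor `sin πx / sin π(x+Φ)`) given the bounds on `Φ` — pure real analysis in
the variables `S = sin πx`, `Cc = cos πx`. [cite: AjankiHuveneers2011, Prop. 3.5 eqs. (3.18)-(3.19)] -/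
theorem log_factor_core {S Cc Φ w b M G C₁ C₃ C₄ C₅ C₆ C₇ C₈ : ℝ} (hSC : S ^ 2 + Cc ^ 2 = 1)
    (hS0 : S ≠ 0) (hw0 : 0 < w) (hw1 : w ≤ 1) (hM0 : 0 ≤ M) (hbM : |b| ≤ M) (hG1 : 1 ≤ G)
    (hC₁ : 0 ≤ C₁) (hΦ : |Φ| ≤ G * w * S ^ 2)
    (hΦ2 : |Φ - S ^ 2 * (w * b + w ^ 2 * b ^ 2 * (π / 2) * (2 * S * Cc))| ≤ C₁ * w ^ 3 * S ^ 2)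
    (hu : π * G * w ≤ 1 / 4)
    (hC₃ : C₃ = (π * M ^ 2 + C₁) * (2 * M + π * M ^ 2 + C₁))
    (hC₄ : C₄ = π ^ 4 * G ^ 4 + π ^ 3 * G ^ 3 + π * C₁ + π ^ 2 * C₃ / 2)
    (hC₅ : C₅ = π * M + 2 * π ^ 2 * M ^ 2 + C₄) (hC₆ : C₆ = 2 * π ^ 2 * M ^ 2 + C₄)
    (hC₇ : C₇ = C₆ * (2 * π * M + C₆)) (hC₈ : C₈ = C₄ + C₇ / 2 + 2 * C₅ ^ 3)
    (hsmall : C₅ * w ≤ 1 / 2) :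
    0 < Real.cos (π * Φ) + Cc / S * Real.sin (π * Φ) ∧
      |-Real.log (Real.cos (π * Φ) + Cc / S * Real.sin (π * Φ)) -
          (w * (-(π * S * Cc)) * b + w ^ 2 * (-(π ^ 2 / 2) * S ^ 2 * (Cc ^ 2 - S ^ 2)) * b ^ 2)|
        ≤ C₈ * w ^ 3 := by
  have hπ := Real.pi_pos
  have hπ3 := Real.pi_gt_three
  have hw2 : w ^ 2 ≤ w := by nlinarith
  have hw3 : w ^ 3 ≤ w ^ 2 := by nlinarith
  have hw3' : w ^ 3 ≤ w := hw3.trans hw2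
  -- sizes of `S`, `Cc`
  have hS2 : S ^ 2 ≤ 1 := by linarith [sq_nonneg Cc]
  have hC2 : Cc ^ 2 ≤ 1 := by linarith [sq_nonneg S]
  have hSa : |S| ≤ 1 := (sq_le_one_iff_abs_le_one S).mp hS2
  have hCa : |Cc| ≤ 1 := (sq_le_one_iff_abs_le_one Cc).mp hC2
  have hS2pos : 0 < S ^ 2 := by positivity
  have hSabs : 0 < |S| := abs_pos.mpr hS0
  have hG0 : 0 ≤ G := by linarith
  have hS4 : S ^ 2 * S ^ 2 ≤ 1 := mul_le_one₀ hS2 hS2pos.le hS2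
  -- nonnegativity of the constants
  have hC₃0 : 0 ≤ C₃ := by rw [hC₃]; positivity
  have hC₄0 : 0 ≤ C₄ := by rw [hC₄]; positivity
  have hC₅0 : 0 ≤ C₅ := by rw [hC₅]; positivity
  have hC₆0 : 0 ≤ C₆ := by rw [hC₆]; positivity
  have hC₇0 : 0 ≤ C₇ := by rw [hC₇]; positivity
  -- the error terms, as exact definitions
  obtain ⟨EΦ, hEΦ⟩ : ∃ E : ℝ, E = Φ - S ^ 2 * (w * b + w ^ 2 * b ^ 2 * (π / 2) * (2 * S * Cc)) :=
    ⟨_, rfl⟩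
  rw [← hEΦ] at hΦ2
  obtain ⟨t, ht⟩ : ∃ t : ℝ, t = π * Φ := ⟨_, rfl⟩
  have ht_abs : |t| ≤ π * G * w * S ^ 2 := by
    rw [ht, abs_mul, abs_of_pos hπ, mul_assoc, mul_assoc]
    exact mul_le_mul_of_nonneg_left (by rw [← mul_assoc]; exact hΦ) hπ.le
  have ht_abs' : |t| ≤ π * G * w := ht_abs.trans (mul_le_of_le_one_right (by positivity) hS2)
  have ht1 : |t| ≤ 1 / 4 := ht_abs'.trans hu
  have ht1' : |t| ≤ 1 := by linarith
  obtain ⟨es, hes⟩ : ∃ e : ℝ, e = Real.sin t - t := ⟨_, rfl⟩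
  obtain ⟨ec, hec⟩ : ∃ e : ℝ, e = Real.cos t - (1 - t ^ 2 / 2) := ⟨_, rfl⟩
  have hes_abs : |es| ≤ |t| ^ 3 := hes ▸ abs_sin_sub_self_le ht1'
  have hec_abs : |ec| ≤ t ^ 4 := hec ▸ abs_cos_sub_le ht1'
  -- `z = d - 1` and its decomposition
  obtain ⟨z, hz⟩ : ∃ z : ℝ, z = Real.cos (π * Φ) + Cc / S * Real.sin (π * Φ) - 1 := ⟨_, rfl⟩
  obtain ⟨z₁, hz₁⟩ : ∃ z₁ : ℝ, z₁ = π * S * Cc * (w * b) := ⟨_, rfl⟩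
  obtain ⟨z₂, hz₂⟩ : ∃ z₂ : ℝ, z₂ = π ^ 2 * w ^ 2 * b ^ 2 * (S ^ 2 * Cc ^ 2 - S ^ 4 / 2) := ⟨_, rfl⟩
  obtain ⟨ez, hez⟩ : ∃ e : ℝ, e = ec + Cc / S * es + π * Cc * EΦ / S -
      π ^ 2 * (Φ ^ 2 - S ^ 4 * w ^ 2 * b ^ 2) / 2 := ⟨_, rfl⟩
  have hz_dec : z = z₁ + z₂ + ez := by
    have hcos : Real.cos (π * Φ) = 1 - t ^ 2 / 2 + ec := by rw [hec, ht]; ring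
    have hsin : Real.sin (π * Φ) = t + es := by rw [hes, ht]; ring
    have hΦeq : Φ = S ^ 2 * (w * b + w ^ 2 * b ^ 2 * (π / 2) * (2 * S * Cc)) + EΦ := by
      rw [hEΦ]; ring
    rw [hz, hcos, hsin, hz₁, hz₂, hez, ht]
    field_simp
    rw [hΦeq]
    ring
  -- bounds on the pieces of `ez`
  have hb2 : b ^ 2 ≤ M ^ 2 := by rw [← sq_abs b]; exact pow_le_pow_left₀ (abs_nonneg b) hbM 2
  have e1 : |ec| ≤ π ^ 4 * G ^ 4 * w ^ 3 := by
    refine hec_abs.trans ?_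
    have h1 : t ^ 4 = |t| ^ 4 := by rw [show (4 : ℕ) = 2 * 2 from rfl, pow_mul, pow_mul, sq_abs]
    rw [h1]
    calc |t| ^ 4 ≤ (π * G * w) ^ 4 := pow_le_pow_left₀ (abs_nonneg t) ht_abs' 4
      _ = π ^ 4 * G ^ 4 * w ^ 3 * w := by ring
      _ ≤ π ^ 4 * G ^ 4 * w ^ 3 * 1 := mul_le_mul_of_nonneg_left hw1 (by positivity)
      _ = π ^ 4 * G ^ 4 * w ^ 3 := mul_one _
  have e2 : |Cc / S * es| ≤ π ^ 3 * G ^ 3 * w ^ 3 := by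
    rw [abs_mul, abs_div]
    have h1 : |es| ≤ (π * G * w * S ^ 2) ^ 3 := hes_abs.trans (pow_le_pow_left₀ (abs_nonneg t) ht_abs 3)
    have hS4' : |S| * (S ^ 2 * S ^ 2) ≤ 1 := mul_le_one₀ hSa (by positivity) hS4
    calc |Cc| / |S| * |es| ≤ 1 / |S| * (π * G * w * S ^ 2) ^ 3 :=
          mul_le_mul (div_le_div_of_nonneg_right hCa hSabs.le) h1 (abs_nonneg _) (by positivity)
      _ = π ^ 3 * G ^ 3 * w ^ 3 * (|S| * (S ^ 2 * S ^ 2)) := by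
          rw [← sq_abs S]; field_simp
      _ ≤ π ^ 3 * G ^ 3 * w ^ 3 * 1 := mul_le_mul_of_nonneg_left hS4' (by positivity)
      _ = π ^ 3 * G ^ 3 * w ^ 3 := mul_one _
  have e3 : |π * Cc * EΦ / S| ≤ π * C₁ * w ^ 3 := by
    rw [abs_div, abs_mul, abs_mul, abs_of_pos hπ, div_le_iff₀ hSabs]
    calc π * |Cc| * |EΦ| ≤ π * 1 * (C₁ * w ^ 3 * S ^ 2) :=
          mul_le_mul (mul_le_mul_of_nonneg_left hCa hπ.le) hΦ2 (abs_nonneg _) (by positivity)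
      _ = π * C₁ * w ^ 3 * (|S| * |S|) := by rw [← sq_abs S]; ring
      _ ≤ π * C₁ * w ^ 3 * (|S| * 1) :=
          mul_le_mul_of_nonneg_left (mul_le_mul_of_nonneg_left hSa hSabs.le) (by positivity)
      _ = π * C₁ * w ^ 3 * |S| := by ring
  have e4 : |π ^ 2 * (Φ ^ 2 - S ^ 4 * w ^ 2 * b ^ 2) / 2| ≤ π ^ 2 * C₃ / 2 * w ^ 3 := by
    -- `Φ² - S⁴w²b² = δ (2S²wb + δ)`, `δ = Φ - S²wb = πw²b²S³Cc + EΦ`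
    obtain ⟨δ, hδ⟩ : ∃ δ : ℝ, δ = Φ - S ^ 2 * (w * b) := ⟨_, rfl⟩
    have hδeq : δ = π * w ^ 2 * b ^ 2 * S ^ 3 * Cc + EΦ := by rw [hδ, hEΦ]; ring
    have hδ_abs : |δ| ≤ (π * M ^ 2 + C₁) * w ^ 2 * S ^ 2 := by
      rw [hδeq]
      refine (abs_add_le _ _).trans ?_
      have h1 : |π * w ^ 2 * b ^ 2 * S ^ 3 * Cc| ≤ π * M ^ 2 * w ^ 2 * S ^ 2 := by
        rw [abs_mul, abs_mul, abs_mul, abs_mul, abs_of_pos hπ, abs_of_nonneg (sq_nonneg w),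
          abs_of_nonneg (sq_nonneg b), show |S ^ 3| = S ^ 2 * |S| by
            rw [abs_pow, ← sq_abs S]; ring]
        calc π * w ^ 2 * b ^ 2 * (S ^ 2 * |S|) * |Cc| ≤ π * w ^ 2 * M ^ 2 * (S ^ 2 * 1) * 1 := by
              gcongr
          _ = π * M ^ 2 * w ^ 2 * S ^ 2 := by ring
      have h2 : |EΦ| ≤ C₁ * w ^ 2 * S ^ 2 :=
        hΦ2.trans (mul_le_mul_of_nonneg_right (mul_le_mul_of_nonneg_left hw3 hC₁) hS2pos.le)
      linarith
    have hsum_abs : |Φ + S ^ 2 * (w * b)| ≤ (2 * M + π * M ^ 2 + C₁) * w * S ^ 2 := by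
      have : Φ + S ^ 2 * (w * b) = 2 * (S ^ 2 * (w * b)) + δ := by rw [hδ]; ring
      rw [this]
      refine (abs_add_le _ _).trans ?_
      have h1 : |2 * (S ^ 2 * (w * b))| ≤ 2 * M * w * S ^ 2 := by
        rw [abs_mul, abs_mul, abs_mul, abs_of_pos (by norm_num : (0:ℝ) < 2), abs_of_nonneg hS2pos.le,
          abs_of_pos hw0]
        calc 2 * (S ^ 2 * (w * |b|)) ≤ 2 * (S ^ 2 * (w * M)) := by gcongr
          _ = 2 * M * w * S ^ 2 := by ring
      have h2 : (π * M ^ 2 + C₁) * w ^ 2 * S ^ 2 ≤ (π * M ^ 2 + C₁) * w * S ^ 2 :=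
        mul_le_mul_of_nonneg_right (mul_le_mul_of_nonneg_left hw2 (by positivity)) hS2pos.le
      linarith
    have hprod : Φ ^ 2 - S ^ 4 * w ^ 2 * b ^ 2 = δ * (Φ + S ^ 2 * (w * b)) := by rw [hδ]; ring
    rw [abs_div, abs_mul, abs_of_pos (by positivity : (0:ℝ) < π ^ 2), abs_of_pos (by norm_num : (0:ℝ) < 2),
      hprod, abs_mul]
    have hkey : |δ| * |Φ + S ^ 2 * (w * b)| ≤ C₃ * w ^ 3 := by
      calc |δ| * |Φ + S ^ 2 * (w * b)|
          ≤ ((π * M ^ 2 + C₁) * w ^ 2 * S ^ 2) * ((2 * M + π * M ^ 2 + C₁) * w * S ^ 2) :=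
            mul_le_mul hδ_abs hsum_abs (abs_nonneg _) (by positivity)
        _ = C₃ * w ^ 3 * (S ^ 2 * S ^ 2) := by rw [hC₃]; ring
        _ ≤ C₃ * w ^ 3 * 1 := mul_le_mul_of_nonneg_left hS4 (by positivity)
        _ = C₃ * w ^ 3 := mul_one _
    rw [div_le_iff₀ (by norm_num : (0:ℝ) < 2)]
    calc π ^ 2 * (|δ| * |Φ + S ^ 2 * (w * b)|) ≤ π ^ 2 * (C₃ * w ^ 3) :=
          mul_le_mul_of_nonneg_left hkey (by positivity)
      _ = π ^ 2 * C₃ / 2 * w ^ 3 * 2 := by ring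
  have hez_abs : |ez| ≤ C₄ * w ^ 3 := by
    rw [hez, hC₄]
    have h1 := abs_add_le (ec + Cc / S * es + π * Cc * EΦ / S) (-(π ^ 2 * (Φ ^ 2 - S ^ 4 * w ^ 2 * b ^ 2) / 2))
    have h2 := abs_add_le (ec + Cc / S * es) (π * Cc * EΦ / S)
    have h3 := abs_add_le ec (Cc / S * es)
    rw [abs_neg] at h1
    rw [sub_eq_add_neg]
    linarith
  -- sizes of `z₁`, `z₂`, `z`
  have hz₁_abs : |z₁| ≤ π * M * w := by
    rw [hz₁, abs_mul, abs_mul, abs_mul, abs_of_pos hπ, abs_mul, abs_of_pos hw0]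
    have : |S| * |Cc| ≤ 1 := mul_le_one₀ hSa (abs_nonneg _) hCa
    calc π * |S| * |Cc| * (w * |b|) = π * (|S| * |Cc|) * (w * |b|) := by ring
      _ ≤ π * 1 * (w * M) := by gcongr
      _ = π * M * w := by ring
  have hz₂_abs : |z₂| ≤ 2 * π ^ 2 * M ^ 2 * w ^ 2 := by
    rw [hz₂, abs_mul, abs_mul, abs_mul, abs_of_pos (by positivity : (0:ℝ) < π ^ 2),
      abs_of_nonneg (sq_nonneg w), abs_of_nonneg (sq_nonneg b)]
    have hSC2 : S ^ 2 * Cc ^ 2 ≤ 1 := mul_le_one₀ hS2 (sq_nonneg _) hC2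
    have hSC0 : 0 ≤ S ^ 2 * Cc ^ 2 := by positivity
    have hS40 : 0 ≤ S ^ 4 := by positivity
    have hS41 : S ^ 4 ≤ 1 := by rw [show S ^ 4 = S ^ 2 * S ^ 2 by ring]; exact hS4
    have h1 : |S ^ 2 * Cc ^ 2 - S ^ 4 / 2| ≤ 2 := by
      rw [abs_le]; constructor <;> linarith
    calc π ^ 2 * w ^ 2 * b ^ 2 * |S ^ 2 * Cc ^ 2 - S ^ 4 / 2| ≤ π ^ 2 * w ^ 2 * M ^ 2 * 2 := by gcongr
      _ = 2 * π ^ 2 * M ^ 2 * w ^ 2 := by ring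
  have hz_abs : |z| ≤ C₅ * w := by
    rw [hz_dec, hC₅]
    have h1 := abs_add_le (z₁ + z₂) ez
    have h2 := abs_add_le z₁ z₂
    have h3 : 2 * π ^ 2 * M ^ 2 * w ^ 2 ≤ 2 * π ^ 2 * M ^ 2 * w :=
      mul_le_mul_of_nonneg_left hw2 (by positivity)
    have h4 : C₄ * w ^ 3 ≤ C₄ * w := mul_le_mul_of_nonneg_left hw3' hC₄0
    linarith
  have hz_half : |z| ≤ 1 / 2 := hz_abs.trans hsmall
  have hd_pos : 0 < 1 + z := by have := (abs_le.mp hz_half).1; linarith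
  -- the logarithm
  obtain ⟨eL, heL⟩ : ∃ e : ℝ, e = Real.log (1 + z) - (z - z ^ 2 / 2) := ⟨_, rfl⟩
  have heL_abs : |eL| ≤ 2 * C₅ ^ 3 * w ^ 3 := by
    rw [heL]
    refine (abs_log_one_add_sub_le hz_half).trans ?_
    have h1 := pow_le_pow_left₀ (abs_nonneg z) hz_abs 3
    have h2 : (C₅ * w) ^ 3 = C₅ ^ 3 * w ^ 3 := by ring
    linarith
  have hζ_abs : |z - z₁| ≤ C₆ * w ^ 2 := by
    rw [hz_dec, hC₆, show z₁ + z₂ + ez - z₁ = z₂ + ez by ring]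
    refine (abs_add_le _ _).trans ?_
    have h4 : C₄ * w ^ 3 ≤ C₄ * w ^ 2 := mul_le_mul_of_nonneg_left hw3 hC₄0
    linarith
  have hsq_abs : |z ^ 2 - z₁ ^ 2| ≤ C₇ * w ^ 3 := by
    have hfac : z ^ 2 - z₁ ^ 2 = (z - z₁) * (2 * z₁ + (z - z₁)) := by ring
    rw [hfac, abs_mul, hC₇]
    have h2 : |2 * z₁ + (z - z₁)| ≤ (2 * π * M + C₆) * w := by
      refine (abs_add_le _ _).trans ?_
      rw [abs_mul, abs_of_pos (by norm_num : (0:ℝ) < 2)]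
      have h5 : C₆ * w ^ 2 ≤ C₆ * w := mul_le_mul_of_nonneg_left hw2 hC₆0
      linarith
    calc |z - z₁| * |2 * z₁ + (z - z₁)| ≤ (C₆ * w ^ 2) * ((2 * π * M + C₆) * w) :=
          mul_le_mul hζ_abs h2 (abs_nonneg _) (by positivity)
      _ = C₆ * (2 * π * M + C₆) * w ^ 3 := by ring
  -- conclusion
  have hd_eq : Real.cos (π * Φ) + Cc / S * Real.sin (π * Φ) = 1 + z := by rw [hz]; ring
  rw [hd_eq]
  refine ⟨hd_pos, ?_⟩
  have hlog : Real.log (1 + z) = z₁ + z₂ + ez - z₁ ^ 2 / 2 - (z ^ 2 - z₁ ^ 2) / 2 + eL := by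
    rw [heL, hz_dec]; ring
  have htarget : -Real.log (1 + z) -
      (w * (-(π * S * Cc)) * b + w ^ 2 * (-(π ^ 2 / 2) * S ^ 2 * (Cc ^ 2 - S ^ 2)) * b ^ 2) =
      -(ez - (z ^ 2 - z₁ ^ 2) / 2 + eL) := by
    rw [hlog, hz₁, hz₂]
    ring
  rw [htarget, abs_neg, hC₈]
  have h1 := abs_add_le (ez - (z ^ 2 - z₁ ^ 2) / 2) eL
  have h2 := abs_sub ez ((z ^ 2 - z₁ ^ 2) / 2)
  have h3 : |(z ^ 2 - z₁ ^ 2) / 2| ≤ C₇ * w ^ 3 / 2 := by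
    rw [abs_div, abs_of_pos (by norm_num : (0:ℝ) < 2)]; linarith
  linarith

/-- **(3.19) for one factor**: `0 < sin πx / sin π(x+Φ(x,b))` and
`|log[sin πx / sin π(x+Φ(x,b))] - (w s(x) b + w² r(x) b²)| ≤ C w³` for `0 < w ≤ w₀`, all `x`,
`b ∈ [b₋, b₊]`. [cite: AjankiHuveneers2011, Prop. 3.5 eqs. (3.18)-(3.19)] -/
theorem log_ahFactor_expansion (bm bp : ℝ) :
    ∃ w₀ : ℝ, 0 < w₀ ∧ ∃ C : ℝ, 0 ≤ C ∧ ∀ w ∈ Set.Ioc 0 w₀, ∀ x : ℝ, ∀ b ∈ Set.Icc bm bp,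
      0 < ahFactor w x b ∧
        |Real.log (ahFactor w x b) - (w * ahS x * b + w ^ 2 * ahR x * b ^ 2)| ≤ C * w ^ 3 := by
  obtain ⟨wa, hwa, Ca, hCa⟩ := ahPhi_expansion bm bp
  obtain ⟨wb, hwb, G', hG'0, hG'⟩ := ahPhi_abs_le bm bp
  obtain ⟨M, hM⟩ : ∃ M : ℝ, M = max |bm| |bp| := ⟨_, rfl⟩
  have hM0 : 0 ≤ M := hM ▸ le_max_of_le_left (abs_nonneg _)
  obtain ⟨G, hG⟩ : ∃ G : ℝ, G = max G' 1 := ⟨_, rfl⟩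
  have hG1 : 1 ≤ G := hG ▸ le_max_right _ _
  have hGG : G' ≤ G := hG ▸ le_max_left _ _
  obtain ⟨C₁, hC₁⟩ : ∃ C : ℝ, C = |Ca| * M := ⟨_, rfl⟩
  have hC₁0 : 0 ≤ C₁ := by rw [hC₁]; positivity
  obtain ⟨C₃, hC₃⟩ : ∃ C : ℝ, C = (π * M ^ 2 + C₁) * (2 * M + π * M ^ 2 + C₁) := ⟨_, rfl⟩
  obtain ⟨C₄, hC₄⟩ : ∃ C : ℝ, C = π ^ 4 * G ^ 4 + π ^ 3 * G ^ 3 + π * C₁ + π ^ 2 * C₃ / 2 := ⟨_, rfl⟩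
  obtain ⟨C₅, hC₅⟩ : ∃ C : ℝ, C = π * M + 2 * π ^ 2 * M ^ 2 + C₄ := ⟨_, rfl⟩
  obtain ⟨C₆, hC₆⟩ : ∃ C : ℝ, C = 2 * π ^ 2 * M ^ 2 + C₄ := ⟨_, rfl⟩
  obtain ⟨C₇, hC₇⟩ : ∃ C : ℝ, C = C₆ * (2 * π * M + C₆) := ⟨_, rfl⟩
  obtain ⟨C₈, hC₈⟩ : ∃ C : ℝ, C = C₄ + C₇ / 2 + 2 * C₅ ^ 3 := ⟨_, rfl⟩
  have hπ := Real.pi_pos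
  have hG0 : 0 ≤ G := by linarith
  have hC₃0 : 0 ≤ C₃ := by rw [hC₃]; positivity
  have hC₄0 : 0 ≤ C₄ := by rw [hC₄]; positivity
  have hC₅0 : 0 ≤ C₅ := by rw [hC₅]; positivity
  have hC₆0 : 0 ≤ C₆ := by rw [hC₆]; positivity
  have hC₇0 : 0 ≤ C₇ := by rw [hC₇]; positivity
  have hC₈0 : 0 ≤ C₈ := by rw [hC₈]; positivity
  refine ⟨min (min (min wa wb) 1) (min (1 / (4 * π * G)) (1 / (2 * C₅ + 1))), by positivity, C₈, hC₈0, ?_⟩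
  intro w hw x b hb
  obtain ⟨hw0, hw1⟩ := hw
  have hw_a : w ≤ wa := hw1.trans ((min_le_left _ _).trans ((min_le_left _ _).trans (min_le_left _ _)))
  have hw_b : w ≤ wb := hw1.trans ((min_le_left _ _).trans ((min_le_left _ _).trans (min_le_right _ _)))
  have hw_1 : w ≤ 1 := hw1.trans ((min_le_left _ _).trans (min_le_right _ _))
  have hw_G : w ≤ 1 / (4 * π * G) := hw1.trans ((min_le_right _ _).trans (min_le_left _ _))
  have hw_5 : w ≤ 1 / (2 * C₅ + 1) := hw1.trans ((min_le_right _ _).trans (min_le_right _ _))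
  have hu : π * G * w ≤ 1 / 4 := by
    calc π * G * w ≤ π * G * (1 / (4 * π * G)) := mul_le_mul_of_nonneg_left hw_G (by positivity)
      _ = 1 / 4 := by field_simp
  have hsmall : C₅ * w ≤ 1 / 2 := by
    calc C₅ * w ≤ C₅ * (1 / (2 * C₅ + 1)) := mul_le_mul_of_nonneg_left hw_5 hC₅0
      _ ≤ 1 / 2 := by rw [mul_one_div, div_le_iff₀ (by positivity)]; linarith
  have hbM : |b| ≤ M := by
    rw [hM]
    rcases le_or_gt 0 b with h | h
    · rw [abs_of_nonneg h]
      exact le_trans (le_trans hb.2 (le_abs_self _)) (le_max_right _ _)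
    · rw [abs_of_neg h]
      exact le_trans (le_trans (neg_le_neg hb.1) (neg_le_abs _)) (le_max_left _ _)
  -- the two expansions of `Φ`, in the variables `S = sin πx`, `Cc = cos πx`
  have hΦ : |ahPhi w x b| ≤ G * w * Real.sin (π * x) ^ 2 :=
    (hG' w ⟨hw0, hw_b⟩ x b hb).trans (mul_le_mul_of_nonneg_right
      (mul_le_mul_of_nonneg_right hGG hw0.le) (sq_nonneg _))
  have hΦ2 : |ahPhi w x b - Real.sin (π * x) ^ 2 * (w * b + w ^ 2 * b ^ 2 * (π / 2) *
      (2 * Real.sin (π * x) * Real.cos (π * x)))| ≤ C₁ * w ^ 3 * Real.sin (π * x) ^ 2 := by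
    have h := hCa w ⟨hw0, hw_a⟩ x b hb
    rw [show 2 * π * x = 2 * (π * x) by ring, Real.sin_two_mul] at h
    refine h.trans ?_
    rw [hC₁]
    calc Ca * w ^ 3 * |b| * Real.sin (π * x) ^ 2 ≤ |Ca| * w ^ 3 * |b| * Real.sin (π * x) ^ 2 := by
          gcongr; exact le_abs_self _
      _ ≤ |Ca| * w ^ 3 * M * Real.sin (π * x) ^ 2 := by gcongr
      _ = |Ca| * M * w ^ 3 * Real.sin (π * x) ^ 2 := by ring
  -- `s` and `r` in these variables
  have hSC := Real.sin_sq_add_cos_sq (π * x)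
  have hs : ahS x = -(π * Real.sin (π * x) * Real.cos (π * x)) := by
    rw [ahS, show 2 * π * x = 2 * (π * x) by ring, Real.sin_two_mul]; ring
  have hr : ahR x = -(π ^ 2 / 2) * Real.sin (π * x) ^ 2 * (Real.cos (π * x) ^ 2 - Real.sin (π * x) ^ 2) := by
    rw [ahR, show 2 * π * x = 2 * (π * x) by ring, Real.cos_two_mul']
    have hc : Real.cos (π * x) ^ 2 = 1 - Real.sin (π * x) ^ 2 := by linarith
    rw [hc]; ring
  by_cases hS00 : Real.sin (π * x) = 0
  · -- degenerate factor: everything vanishes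
    have hf : ahFactor w x b = 1 := by simp [ahFactor, hS00]
    rw [hf, Real.log_one, hs, hr, hS00]
    simp only [mul_zero, zero_mul, neg_zero, zero_pow two_ne_zero, sub_zero, add_zero, abs_zero]
    exact ⟨one_pos, by positivity⟩
  -- the main case
  obtain ⟨d, hd⟩ : ∃ d : ℝ, d = Real.cos (π * ahPhi w x b) +
      Real.cos (π * x) / Real.sin (π * x) * Real.sin (π * ahPhi w x b) := ⟨_, rfl⟩
  have hsin : Real.sin (π * (x + ahPhi w x b)) = Real.sin (π * x) * d := by
    rw [mul_add, Real.sin_add, hd]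
    field_simp
  have hfac : ahFactor w x b = 1 / d := by
    rw [ahFactor, if_neg hS00, hsin]
    field_simp
  obtain ⟨hdpos, hcore⟩ := log_factor_core hSC hS00 hw0 hw_1 hM0 hbM hG1 hC₁0 hΦ hΦ2 hu
    hC₃ hC₄ hC₅ hC₆ hC₇ hC₈ hsmall
  rw [← hd] at hdpos hcore
  rw [hfac, hs, hr, one_div, Real.log_inv]
  exact ⟨inv_pos.mpr hdpos, by simpa [neg_mul] using hcore⟩

end Literature.Barriers.AtomisticToContinuum.HeatConduction

namespace Literature.Barriers.AtomisticToContinuum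

open HeatConduction Finset

/-- **(3.11) discharged.** [cite: AjankiHuveneers2011, Lemma 3.2 eq. (3.11)] -/
theorem AjankiHuveneers2011_PhiExpansion_holds : AjankiHuveneers2011_PhiExpansion :=
  fun bm bp _ _ => ahPhi_expansion bm bp

/-- **Cor. 3.4 (i) discharged.** [cite: AjankiHuveneers2011, Cor. 3.4 (i)] -/
theorem AjankiHuveneers2011_phaseMonotone_holds : AjankiHuveneers2011_phaseMonotone :=
  fun bm bp hbm hbm0 hbp => ahStep_increment_bounds bm bp hbm hbm0 hbp

/-- **(3.21) discharged**: summing the per-factor expansion (3.19) over the `n - 1` factors of the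
amplitude `Γ^x_n`. [cite: AjankiHuveneers2011, Prop. 3.5 eqs. (3.19)-(3.21)] -/
theorem AjankiHuveneers2011_logGammaExpansion_holds : AjankiHuveneers2011_logGammaExpansion := by
  intro bm bp _ _
  obtain ⟨w₀, hw₀, C, hC0, hC⟩ := log_ahFactor_expansion bm bp
  refine ⟨w₀, hw₀, C, ?_⟩
  intro w hw x B hB n
  have hfac : ∀ l, 0 < ahFactor w (ahPhase w x B l) (B l) ∧
      |Real.log (ahFactor w (ahPhase w x B l) (B l)) -
        (w * ahS (ahPhase w x B l) * B l + w ^ 2 * ahR (ahPhase w x B l) * B l ^ 2)| ≤ C * w ^ 3 :=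
    fun l => hC w hw (ahPhase w x B l) (B l) (hB l)
  have hpos : 0 < ahGamma w x B n := Finset.prod_pos fun l _ => (hfac l).1
  refine ⟨hpos, ?_⟩
  rw [ahGamma, Real.log_prod (fun l _ => (hfac l).1.ne'), ← Finset.sum_sub_distrib]
  calc |∑ l ∈ Ico 1 n, (Real.log (ahFactor w (ahPhase w x B l) (B l)) -
        (w * ahS (ahPhase w x B l) * B l + w ^ 2 * ahR (ahPhase w x B l) * B l ^ 2))|
      ≤ ∑ l ∈ Ico 1 n, |Real.log (ahFactor w (ahPhase w x B l) (B l)) -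
        (w * ahS (ahPhase w x B l) * B l + w ^ 2 * ahR (ahPhase w x B l) * B l ^ 2)| :=
        Finset.abs_sum_le_sum_abs _ _
    _ ≤ ∑ _l ∈ Ico 1 n, C * w ^ 3 := Finset.sum_le_sum fun l _ => (hfac l).2
    _ = (n - 1 : ℕ) * (C * w ^ 3) := by rw [Finset.sum_const, Nat.card_Ico, nsmul_eq_mul]
    _ ≤ n * (C * w ^ 3) := by
        have hw0 : 0 < w := hw.1
        refine mul_le_mul_of_nonneg_right ?_ (by positivity)
        exact_mod_cast Nat.sub_le n 1
    _ = C * w ^ 3 * n := by ring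

end Literature.Barriers.AtomisticToContinuum

end
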